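import Summits.QuantumFields.QCD.Theses.GapBuysCauchyRate
import Summits.QuantumFields.QCD.Theorems.GapBuysCauchyRateLadderCauchyRateStubGlueTwoPointReal

/-!
# Stub `stub_skewnessTransfer` (W6) of line `birth` for crux `GapBuysCauchyRate.LadderCauchyRate`
(item stmt-QuantumFields-17307, route route-QuantumFields-GapBuysCauchyRate, sub-problem QCD)

What is proved: the skewness transfer law (W6) of reshape r8.  For a calibrated species family `𝒞`
over a regularisation `reg` which is PINNED — its additive counterterms are the bare one-point
expectations `shift_s(m,k) = Re ⟨O_s(0)⟩_{k,m}` of the bare torus functional (hypothesis `hPS`), and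
its multiplicative renormalisations are `z_s(m,k) = (Re B_s(m,k))^{-1/2}` whenever the bare
(`z ≡ 1`) connected reference function `B_s(m,k) = ⟨Φ^s(Θf₀) Φ^s(f₀)⟩_conn` is a positive real and a
fixed fallback `ζ` otherwise (hypothesis `hPZ`) — and a mass tuple `m` at which the bare `glue`
reference function has eventually positive real part, the two forms of BARE GLUE SKEWNESS are
equivalent: the `𝒞`-free form (`∃` slab test functions `f, g, h` and `ε > 0` with
`ε (√Re B_glue(m,k))³ ≤ ‖S₃^{bare}(k; f, g, h)‖` eventually in `k`) and the per-family scale-free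
form (`ε ≤ z_glue(m,k)³ ‖S₃^{bare}(k; f, g, h)‖` eventually), `S₃^{bare}` the three-point `glue`
function of the `z ≡ 1` scheme with the pinned shifts.

How: by `hPS` the family's shift function at `m` IS the pinned shift function (`funext`), so both
sides speak about the same scheme.  The bare `glue` connected reference function is always real:
`⟨ΦΦ⟩_conn = S₂ − S₁ S₁` (`QCDScheme.connectedTwoPoint`) with `S₁^{glue}`, `S₂^{glue,glue}` real by
the landed reality law `stub_glueTwoPointReal` (W4).  Hence on the eventual set where `Re B > 0` the
first branch of `hPZ` gives `z_glue(m,k) = r⁻¹` with `r = √Re B > 0`, and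
`ε ≤ r⁻³ ‖S₃‖ ⟺ ε r³ ≤ ‖S₃‖`; the same `f, g, h, ε` serve both directions.  Sources: Montvay–Münster
1994 §1.7 (1.251)–(1.253), §5.1 (wave-function renormalisation condition, composite fields);
Glimm–Jaffe 1987 §6.1 (truncated functions).  Everything is proved.

Pure theorem file (no definitions): the registered stub signature, proved in tree vocabulary.
-/

noncomputable section

namespace Summit.QuantumFields.QCD.Cruxes.LadderCauchyRate.Birth

open scoped BigOperators Topology
open MeasureTheory Filter
open Literature.MathematicalPhysics.AQFT Literature.Probability.LatticeModels
  Literature.MathematicalPhysics.QuantumLattice Literature.MathematicalPhysics.QuantumFieldTheory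
open Summit.QuantumFields.QCD.Theses.GapBuysCauchyRate

variable {Nf : ℕ}

/-- **Rescaling an eventual lower bound**: for `r > 0`, `ε ≤ r⁻³ S ⟺ ε r³ ≤ S`. -/
private theorem le_inv_pow_three_mul_iff {ε r S : ℝ} (hr : 0 < r) :
    ε ≤ r⁻¹ ^ 3 * S ↔ ε * r ^ 3 ≤ S := by
  rw [inv_pow, inv_mul_eq_div, le_div_iff₀ (pow_pos hr 3)]

/-- **The bare `glue` connected reference function is real**: `⟨Φ^{glue}(g) Φ^{glue}(f)⟩_conn =
S₂ − S₁(g) S₁(f)` has vanishing imaginary part, since `S₁^{glue}` and `S₂^{glue,glue}` are real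
(`stub_glueTwoPointReal`, W4). -/
private theorem connectedTwoPoint_glue_im (reg : QCDRegularisation Nf) (m : Fin Nf → ℝ)
    (z shift : QCDField Nf → ℕ → ℝ) (k : ℕ) (g f : SchwartzMap (EuclideanSpace ℝ (Fin 4)) ℝ) :
    ((reg.scheme m z shift).connectedTwoPoint k QCDField.glue QCDField.glue g f).im = 0 := by
  obtain ⟨h1f, h2⟩ := stub_glueTwoPointReal Nf reg m z shift k g f
  obtain ⟨h1g, -⟩ := stub_glueTwoPointReal Nf reg m z shift k f g
  simp only [QCDScheme.connectedTwoPoint, Complex.sub_im, Complex.mul_im, h1f, h1g, h2, mul_zero,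
    zero_mul, add_zero, sub_zero]

/-- (W6) **skewness transfer**: for a pinned family with eventually positive bare glue reference
function, 𝒞-free bare skewness ⟺ per-family scale-free skewness (size S/M, provable now: the pinned
shifts identify the two schemes, the bare `glue` reference function is real by W4, so
`z_glue = (√Re B)⁻¹` eventually and `ε ≤ z³ ‖S₃‖ ⟺ ε (√Re B)³ ≤ ‖S₃‖`).  Registered in tree
vocabulary (= `SkewnessTransferStmt` written out). -/
theorem stub_skewnessTransfer :
    ∀ (Nf : ℕ) (reg : QCDRegularisation Nf) (𝒞 : CalibratedSpeciesFamily reg)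
      (ζ : (Fin Nf → ℝ) → QCDField Nf → ℕ → ℝ) (m : Fin Nf → ℝ),
      (∀ (m : Fin Nf → ℝ) (s : QCDField Nf) (k : ℕ),
        𝒞.shift m s k =
          (qcdTorusExpect (reg.β k) (2 * reg.L k + 1) (fun fl => (reg.scheme m 0 0).mq fl k)
            (fun U => insertion U s 0)).re) →
      (∀ (m : Fin Nf → ℝ) (s : QCDField Nf) (k : ℕ),
        ((0 < ((reg.scheme m (fun _ _ => (1 : ℝ)) (𝒞.shift m)).connectedTwoPoint k s s (thetaTest 4 𝒞.f₀) 𝒞.f₀).re ∧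
            ((reg.scheme m (fun _ _ => (1 : ℝ)) (𝒞.shift m)).connectedTwoPoint k s s (thetaTest 4 𝒞.f₀) 𝒞.f₀).im = 0) →
          𝒞.z m s k =
            (Real.sqrt ((reg.scheme m (fun _ _ => (1 : ℝ)) (𝒞.shift m)).connectedTwoPoint k s s
              (thetaTest 4 𝒞.f₀) 𝒞.f₀).re)⁻¹) ∧
        (¬ (0 < ((reg.scheme m (fun _ _ => (1 : ℝ)) (𝒞.shift m)).connectedTwoPoint k s s (thetaTest 4 𝒞.f₀) 𝒞.f₀).re ∧
            ((reg.scheme m (fun _ _ => (1 : ℝ)) (𝒞.shift m)).connectedTwoPoint k s s (thetaTest 4 𝒞.f₀) 𝒞.f₀).im = 0) →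
          𝒞.z m s k = ζ m s k)) →
      (∀ᶠ k in Filter.atTop,
        0 < ((reg.scheme m (fun _ _ => (1 : ℝ))
          (fun s k => (qcdTorusExpect (reg.β k) (2 * reg.L k + 1) (fun fl => (reg.scheme m 0 0).mq fl k)
            (fun U => insertion U s 0)).re)).connectedTwoPoint k QCDField.glue QCDField.glue
              (thetaTest 4 𝒞.f₀) 𝒞.f₀).re) →
      ((∃ f g h : SchwartzMap (EuclideanSpace ℝ (Fin 4)) ℝ,
          tsupport (f : EuclideanSpace ℝ (Fin 4) → ℝ) ⊆ {x | x 0 < 0} ∧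
          tsupport (g : EuclideanSpace ℝ (Fin 4) → ℝ) ⊆ {x | 0 < x 0 ∧ x 0 < 1} ∧
          tsupport (h : EuclideanSpace ℝ (Fin 4) → ℝ) ⊆ {x | 1 < x 0} ∧
          ∃ ε > (0 : ℝ), ∀ᶠ k in Filter.atTop,
            ε * Real.sqrt (((reg.scheme m (fun _ _ => (1 : ℝ))
              (fun s k => (qcdTorusExpect (reg.β k) (2 * reg.L k + 1) (fun fl => (reg.scheme m 0 0).mq fl k)
                (fun U => insertion U s 0)).re)).connectedTwoPoint k QCDField.glue QCDField.glue
                  (thetaTest 4 𝒞.f₀) 𝒞.f₀).re) ^ 3 ≤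
              ‖qcdLatticeSchwinger (reg.scheme m (fun _ _ => (1 : ℝ))
                (fun s k => (qcdTorusExpect (reg.β k) (2 * reg.L k + 1) (fun fl => (reg.scheme m 0 0).mq fl k)
                  (fun U => insertion U s 0)).re)) k 3
                ![QCDField.glue, QCDField.glue, QCDField.glue] ![f, g, h]‖) ↔
        (∃ f g h : SchwartzMap (EuclideanSpace ℝ (Fin 4)) ℝ,
          tsupport (f : EuclideanSpace ℝ (Fin 4) → ℝ) ⊆ {x | x 0 < 0} ∧
          tsupport (g : EuclideanSpace ℝ (Fin 4) → ℝ) ⊆ {x | 0 < x 0 ∧ x 0 < 1} ∧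
          tsupport (h : EuclideanSpace ℝ (Fin 4) → ℝ) ⊆ {x | 1 < x 0} ∧
          ∃ ε > (0 : ℝ), ∀ᶠ k in Filter.atTop,
            ε ≤ (𝒞.z m QCDField.glue k) ^ 3 *
              ‖qcdLatticeSchwinger (reg.scheme m (fun _ _ => (1 : ℝ)) (𝒞.shift m)) k 3
                ![QCDField.glue, QCDField.glue, QCDField.glue] ![f, g, h]‖)) := by
  intro _ reg 𝒞 _ m hPS hPZ hpos
  -- the family's shifts at `m` ARE the pinned shifts
  have hsh : 𝒞.shift m = fun s k =>
      (qcdTorusExpect (reg.β k) (2 * reg.L k + 1) (fun fl => (reg.scheme m 0 0).mq fl k)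
        (fun U => insertion U s 0)).re :=
    funext fun s => funext fun k => hPS m s k
  have hZ := hPZ m QCDField.glue
  rw [hsh] at hZ ⊢
  constructor
  · rintro ⟨f, g, h, hf, hg, hh, ε, hε, hev⟩
    refine ⟨f, g, h, hf, hg, hh, ε, hε, ?_⟩
    filter_upwards [hev, hpos] with k hk hposk
    rw [(hZ k).1 ⟨hposk, connectedTwoPoint_glue_im reg m _ _ k _ _⟩,
      le_inv_pow_three_mul_iff (Real.sqrt_pos.2 hposk)]
    exact hk
  · rintro ⟨f, g, h, hf, hg, hh, ε, hε, hev⟩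
    refine ⟨f, g, h, hf, hg, hh, ε, hε, ?_⟩
    filter_upwards [hev, hpos] with k hk hposk
    rw [(hZ k).1 ⟨hposk, connectedTwoPoint_glue_im reg m _ _ k _ _⟩,
      le_inv_pow_three_mul_iff (Real.sqrt_pos.2 hposk)] at hk
    exact hk

end Summit.QuantumFields.QCD.Cruxes.LadderCauchyRate.Birth

end
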